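import Literature.MathematicalPhysics.QuantumLattice.HubbardCommutatorBound
import Literature.MathematicalPhysics.QuantumLattice.DWaveSourceProofs

/-!
# Route `ThermalWedge` — support item `TwApproximatingHamiltonian` (stmt-HubbardSuperconductivity-1703),
helper file 2/3: graded-locality commutator bounds for the pair field on the torus

Bogoliubov Jr.'s approximating-Hamiltonian estimate (tree:
`Literature.MathematicalPhysics.QuantumLattice.exists_pressure_model_le`) needs, for the channel
`W = √g·Δ_φ` on the torus of side `L` (`Δ_φ = pairField φ L = Σ_x P_x`, `V = L²`), volume-LINEAR
bounds on `‖[W, Wᴴ]‖` and `‖[W, T]‖` (`T = hubbardTorusWith 2 L t U μ`). Both follow from graded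
locality in the CAR algebra (Bratteli–Robinson II §5.2.2; tree `commute_of_mem_carEvenSubalgebra`,
`norm_commutator_hamiltonianWith_le`): `P_x` is an EVEN element localised on the `≤ 5` sites
`x + e`, `e ∈ {0, ±e₁, ±e₂}`, so
* `[P_x, P_yᴴ] = 0` unless the supports meet, which happens for at most `25` values of `y`
  (`y = x + e' − e`): `‖[Δ_φ, Δ_φᴴ]‖ ≤ 25 · 2‖P‖² · L²` (`twAhm_norm_comm_pairField_conjTranspose_le`);
* `‖[T, P_x]‖ ≤ 5·9·2(2|t|+|U|+2|μ|)‖P_x‖` (only the `≤ 45` local terms of `T` meeting the support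
  survive), so `‖[T, Δ_φ]‖ ≤ 45·2(2|t|+|U|+2|μ|)‖P‖·L²` (`twAhm_norm_comm_hubbardTorusWith_pairField_le`),
with `‖P_x‖ ≤ ‖P‖ := 2 Σ_e |φ e/√2|` (`norm_localPair_le`).
The support bookkeeping is adapted from the standing disprover's workfile
`Cruxes/TwSourcedInertness/Disproof.lean` §G (refuter-cdisprove-stmt-HubbardSuperconductivity-1696).
-/

noncomputable section

namespace Summit.HubbardSuperconductivity.HubbardSuperconductivity.Theorems

open Literature.MathematicalPhysics.QuantumLattice Matrix Finset
open Literature.Probability.LatticeModels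
open scoped Matrix.Norms.L2Operator

section CarGeneric

variable {Λ : Type*} [LinearOrder Λ] [Fintype Λ]

/-- `c_i c_j` is even. Bratteli–Robinson II §5.2.2. [folklore] -/
theorem twAhm_annihilation_mul_annihilation_mem {S : Finset (Orb Λ)} {i j : Orb Λ}
    (hi : i ∈ S) (hj : j ∈ S) : annihilation i * annihilation j ∈ carEvenSubalgebra S :=
  Algebra.subset_adjoin ⟨(i, false), (j, false), hi, hj, rfl⟩

/-- `c†_i c†_j` is even. Bratteli–Robinson II §5.2.2. [folklore] -/
theorem twAhm_creation_mul_creation_mem {S : Finset (Orb Λ)} {i j : Orb Λ}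
    (hi : i ∈ S) (hj : j ∈ S) : creation i * creation j ∈ carEvenSubalgebra S :=
  Algebra.subset_adjoin ⟨(i, true), (j, true), hi, hj, rfl⟩

/-- A singlet-pair sum `Σ_e κ_e (c_{X↑} c_{Y_e↓} − c_{X↓} c_{Y_e↑})` is even on any site set
containing `X` and the `Y_e`. Bratteli–Robinson II §5.2.2. [folklore] -/
theorem twAhm_pairSum_mem_carEvenSubalgebra {τ : Type*} (T : Finset τ) (κ : τ → ℝ) (X : Λ)
    (Y : τ → Λ) {S : Finset Λ} (hX : X ∈ S) (hY : ∀ e ∈ T, Y e ∈ S) :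
    (∑ e ∈ T, ((κ e : ℝ) : ℂ) •
        (annihilation (orb X 0) * annihilation (orb (Y e) 1) -
          annihilation (orb X 1) * annihilation (orb (Y e) 0))) ∈ carEvenSubalgebra (orbSet S) := by
  refine Subalgebra.sum_mem _ fun e he => Subalgebra.smul_mem _ (Subalgebra.sub_mem _ ?_ ?_) _
  · exact twAhm_annihilation_mul_annihilation_mem (orb_mem_orbSet hX _)
      (orb_mem_orbSet (hY e he) _)
  · exact twAhm_annihilation_mul_annihilation_mem (orb_mem_orbSet hX _)
      (orb_mem_orbSet (hY e he) _)

/-- … and so is its adjoint. Bratteli–Robinson II §5.2.2. [folklore] -/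
theorem twAhm_pairSum_conjTranspose_mem_carEvenSubalgebra {τ : Type*} (T : Finset τ) (κ : τ → ℝ)
    (X : Λ) (Y : τ → Λ) {S : Finset Λ} (hX : X ∈ S) (hY : ∀ e ∈ T, Y e ∈ S) :
    (∑ e ∈ T, ((κ e : ℝ) : ℂ) •
        (annihilation (orb X 0) * annihilation (orb (Y e) 1) -
          annihilation (orb X 1) * annihilation (orb (Y e) 0)))ᴴ ∈
      carEvenSubalgebra (orbSet S) := by
  rw [conjTranspose_sum]
  refine Subalgebra.sum_mem _ fun e he => ?_
  rw [conjTranspose_smul, conjTranspose_sub, conjTranspose_mul, conjTranspose_mul,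
    annihilation_conjTranspose, annihilation_conjTranspose, annihilation_conjTranspose,
    annihilation_conjTranspose]
  refine Subalgebra.smul_mem _ (Subalgebra.sub_mem _ ?_ ?_) _
  · exact twAhm_creation_mul_creation_mem (orb_mem_orbSet (hY e he) _) (orb_mem_orbSet hX _)
  · exact twAhm_creation_mul_creation_mem (orb_mem_orbSet (hY e he) _) (orb_mem_orbSet hX _)

end CarGeneric

section Torus

variable (L : ℕ) [NeZero L]

omit [NeZero L] in
/-- `proj L 0 = 0`. [folklore] -/
theorem twAhm_proj_zero : Torus.proj L (0 : Site 2) = 0 := by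
  funext i; simp [Torus.proj]

omit [NeZero L] in
/-- `|{0, ±e₁, ±e₂}| ≤ 5`. [folklore] -/
theorem twAhm_card_steps_le : (insert (0 : Site 2) unitSteps).card ≤ 5 := by
  refine (Finset.card_insert_le _ _).trans ?_
  have : unitSteps.card ≤ 4 := by
    unfold unitSteps
    refine (Finset.card_insert_le _ _).trans ?_
    refine (Nat.succ_le_succ (Finset.card_insert_le _ _)).trans ?_
    refine (Nat.succ_le_succ (Nat.succ_le_succ (Finset.card_insert_le _ _))).trans ?_
    rw [Finset.card_singleton]
  omega

/-- The (at most five) sites `x + e`, `e ∈ {0, ±e₁, ±e₂}`, carrying the local pair `P_x`, have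
cardinality `≤ 5`. [folklore] -/
theorem twAhm_card_supp_le (x : TorusSite 2 L) :
    ((insert (0 : Site 2) unitSteps).image
        fun e => FermionTorus.ofTorusSite (x + Torus.proj L e)).card ≤ 5 :=
  Finset.card_image_le.trans twAhm_card_steps_le

/-- `x` itself belongs to the support of `P_x` (`e = 0`). [folklore] -/
theorem twAhm_self_mem_supp (x : TorusSite 2 L) :
    FermionTorus.ofTorusSite x ∈ (insert (0 : Site 2) unitSteps).image
      fun e => FermionTorus.ofTorusSite (x + Torus.proj L e) :=
  Finset.mem_image.2 ⟨0, Finset.mem_insert_self _ _, by rw [twAhm_proj_zero, add_zero]⟩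

/-- **`P_x` is an even element of the CAR algebra of its support.** Bratteli–Robinson II §5.2.2.
[folklore] -/
theorem twAhm_localPair_mem_carEvenSubalgebra (φ : Site 2 → ℝ) (x : TorusSite 2 L) :
    localPair φ L x ∈ carEvenSubalgebra (orbSet ((insert (0 : Site 2) unitSteps).image
      fun e => FermionTorus.ofTorusSite (x + Torus.proj L e))) :=
  twAhm_pairSum_mem_carEvenSubalgebra (insert (0 : Site 2) unitSteps) (fun e => φ e / Real.sqrt 2)
    (FermionTorus.ofTorusSite x) (fun e => FermionTorus.ofTorusSite (x + Torus.proj L e))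
    (twAhm_self_mem_supp L x) (fun _ he => Finset.mem_image_of_mem _ he)

/-- **`P_xᴴ` is an even element of the CAR algebra of the same support.** [folklore] -/
theorem twAhm_localPair_conjTranspose_mem_carEvenSubalgebra (φ : Site 2 → ℝ) (x : TorusSite 2 L) :
    (localPair φ L x)ᴴ ∈ carEvenSubalgebra (orbSet ((insert (0 : Site 2) unitSteps).image
      fun e => FermionTorus.ofTorusSite (x + Torus.proj L e))) :=
  twAhm_pairSum_conjTranspose_mem_carEvenSubalgebra (insert (0 : Site 2) unitSteps)
    (fun e => φ e / Real.sqrt 2) (FermionTorus.ofTorusSite x)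
    (fun e => FermionTorus.ofTorusSite (x + Torus.proj L e))
    (twAhm_self_mem_supp L x) (fun _ he => Finset.mem_image_of_mem _ he)

/-- Graded locality: `[P_x, P_yᴴ] = 0` when the supports are disjoint. Bratteli–Robinson II
§5.2.2. [folklore] -/
theorem twAhm_comm_localPair_eq_zero (φ : Site 2 → ℝ) {x y : TorusSite 2 L}
    (h : Disjoint ((insert (0 : Site 2) unitSteps).image
        fun e => FermionTorus.ofTorusSite (x + Torus.proj L e))
      ((insert (0 : Site 2) unitSteps).image
        fun e => FermionTorus.ofTorusSite (y + Torus.proj L e))) :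
    localPair φ L x * (localPair φ L y)ᴴ - (localPair φ L y)ᴴ * localPair φ L x = 0 :=
  sub_eq_zero.mpr (commute_of_mem_carEvenSubalgebra (twAhm_localPair_mem_carEvenSubalgebra L φ x)
    (carEvenSubalgebra_le_carSubalgebra _ (twAhm_localPair_conjTranspose_mem_carEvenSubalgebra L φ y))
    (disjoint_orbSet h)).eq

/-- If the supports of `P_x` and `P_y` meet then `y = x + e' − e` for some steps `e, e'`.
[folklore] -/
theorem twAhm_mem_candidates {x y : TorusSite 2 L}
    (h : ¬ Disjoint ((insert (0 : Site 2) unitSteps).image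
        fun e => FermionTorus.ofTorusSite (x + Torus.proj L e))
      ((insert (0 : Site 2) unitSteps).image
        fun e => FermionTorus.ofTorusSite (y + Torus.proj L e))) :
    y ∈ ((insert (0 : Site 2) unitSteps) ×ˢ (insert (0 : Site 2) unitSteps)).image
      fun p => x + Torus.proj L p.1 - Torus.proj L p.2 := by
  rw [Finset.not_disjoint_iff] at h
  obtain ⟨w, hwx, hwy⟩ := h
  obtain ⟨e', he', rfl⟩ := Finset.mem_image.1 hwx
  obtain ⟨e, he, hw⟩ := Finset.mem_image.1 hwy
  have hxy : y + Torus.proj L e = x + Torus.proj L e' := by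
    have := congrArg FermionTorus.toTorusSite hw
    simpa using this
  refine Finset.mem_image.2 ⟨(e', e), Finset.mem_product.2 ⟨he', he⟩, ?_⟩
  simp only
  rw [← hxy, add_sub_cancel_right]

omit [NeZero L] in
/-- … so there are at most `25` such `y`. [folklore] -/
theorem twAhm_card_candidates_le (x : TorusSite 2 L) :
    (((insert (0 : Site 2) unitSteps) ×ˢ (insert (0 : Site 2) unitSteps)).image
      fun p => x + Torus.proj L p.1 - Torus.proj L p.2).card ≤ 25 := by
  refine Finset.card_image_le.trans ?_
  rw [Finset.card_product]
  have h5 := twAhm_card_steps_le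
  calc (insert (0 : Site 2) unitSteps).card * (insert (0 : Site 2) unitSteps).card ≤ 5 * 5 :=
        Nat.mul_le_mul h5 h5
    _ = 25 := by norm_num

/-- `|Λ_L| = L²`. [folklore] -/
theorem twAhm_card_torusSite : (Fintype.card (TorusSite 2 L) : ℝ) = (L : ℝ) ^ 2 := by
  rw [Fintype.card_pi, prod_const, ZMod.card, card_univ, Fintype.card_fin]
  push_cast
  ring

/-- **`‖[Δ_φ, Δ_φᴴ]‖ ≤ 25 · 2‖P‖² · L²`** with `‖P‖ = 2 Σ_e |φ e/√2|` (graded locality: for each `x`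
at most `25` adjoint local pairs fail to commute with `P_x`). Bratteli–Robinson II §5.2.2.
[folklore] -/
theorem twAhm_norm_comm_pairField_conjTranspose_le (φ : Site 2 → ℝ) :
    ‖pairField φ L * (pairField φ L)ᴴ - (pairField φ L)ᴴ * pairField φ L‖ ≤
      25 * (2 * (2 * ∑ e ∈ insert (0 : Site 2) unitSteps, |φ e / Real.sqrt 2|) ^ 2) *
        (L : ℝ) ^ 2 := by
  classical
  set p : ℝ := 2 * ∑ e ∈ insert (0 : Site 2) unitSteps, |φ e / Real.sqrt 2| with hp
  have hp0 : 0 ≤ p := by positivity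
  have hP : ∀ x : TorusSite 2 L, ‖localPair φ L x‖ ≤ p := fun x => norm_localPair_le φ L x
  set T : TorusSite 2 L → TorusSite 2 L →
      Matrix (Finset (Orb (FermionTorus 2 L))) (Finset (Orb (FermionTorus 2 L))) ℂ :=
    fun x y => localPair φ L x * (localPair φ L y)ᴴ - (localPair φ L y)ᴴ * localPair φ L x with hT
  have hsum : pairField φ L * (pairField φ L)ᴴ - (pairField φ L)ᴴ * pairField φ L =
      ∑ x : TorusSite 2 L, ∑ y : TorusSite 2 L, T x y := by
    have hadj : (pairField φ L)ᴴ = ∑ y : TorusSite 2 L, (localPair φ L y)ᴴ := by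
      rw [pairField, conjTranspose_sum]
    rw [pairField, finset_sum_commutator]
    refine Finset.sum_congr rfl fun x _ => ?_
    rw [← pairField, hadj, Finset.mul_sum, Finset.sum_mul, ← Finset.sum_sub_distrib]
  have hterm : ∀ x y : TorusSite 2 L, ‖T x y‖ ≤ 2 * p ^ 2 := by
    intro x y
    have h1 : ‖(localPair φ L y)ᴴ‖ ≤ p := by rw [l2_opNorm_conjTranspose]; exact hP y
    calc ‖T x y‖ ≤ ‖localPair φ L x * (localPair φ L y)ᴴ‖ + ‖(localPair φ L y)ᴴ * localPair φ L x‖ :=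
          norm_sub_le _ _
      _ ≤ ‖localPair φ L x‖ * ‖(localPair φ L y)ᴴ‖ + ‖(localPair φ L y)ᴴ‖ * ‖localPair φ L x‖ :=
          add_le_add (norm_mul_le _ _) (norm_mul_le _ _)
      _ ≤ p * p + p * p := add_le_add (mul_le_mul (hP x) h1 (norm_nonneg _) hp0)
          (mul_le_mul h1 (hP x) (norm_nonneg _) hp0)
      _ = 2 * p ^ 2 := by ring
  have hx : ∀ x : TorusSite 2 L, ∑ y : TorusSite 2 L, ‖T x y‖ ≤ 25 * (2 * p ^ 2) := by
    intro x
    have hle : ∀ y : TorusSite 2 L, ‖T x y‖ ≤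
        if Disjoint ((insert (0 : Site 2) unitSteps).image
            fun e => FermionTorus.ofTorusSite (x + Torus.proj L e))
          ((insert (0 : Site 2) unitSteps).image
            fun e => FermionTorus.ofTorusSite (y + Torus.proj L e)) then 0 else 2 * p ^ 2 := by
      intro y
      split_ifs with h
      · rw [show T x y = 0 from twAhm_comm_localPair_eq_zero L φ h, norm_zero]
      · exact hterm x y
    calc ∑ y : TorusSite 2 L, ‖T x y‖
        ≤ ∑ y : TorusSite 2 L, (if Disjoint ((insert (0 : Site 2) unitSteps).image
              fun e => FermionTorus.ofTorusSite (x + Torus.proj L e))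
            ((insert (0 : Site 2) unitSteps).image
              fun e => FermionTorus.ofTorusSite (y + Torus.proj L e)) then 0 else 2 * p ^ 2) :=
          Finset.sum_le_sum fun y _ => hle y
      _ = 2 * p ^ 2 * ((Finset.univ.filter fun y : TorusSite 2 L =>
            ¬ Disjoint ((insert (0 : Site 2) unitSteps).image
                fun e => FermionTorus.ofTorusSite (x + Torus.proj L e))
              ((insert (0 : Site 2) unitSteps).image
                fun e => FermionTorus.ofTorusSite (y + Torus.proj L e))).card) := by
          rw [Finset.sum_ite, Finset.sum_const_zero, zero_add, Finset.sum_const, nsmul_eq_mul,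
            mul_comm]
      _ ≤ 2 * p ^ 2 * 25 := by
          gcongr
          have hsub : (Finset.univ.filter fun y : TorusSite 2 L =>
              ¬ Disjoint ((insert (0 : Site 2) unitSteps).image
                  fun e => FermionTorus.ofTorusSite (x + Torus.proj L e))
                ((insert (0 : Site 2) unitSteps).image
                  fun e => FermionTorus.ofTorusSite (y + Torus.proj L e))) ⊆
              ((insert (0 : Site 2) unitSteps) ×ˢ (insert (0 : Site 2) unitSteps)).image
                fun p => x + Torus.proj L p.1 - Torus.proj L p.2 :=
            fun y hy => twAhm_mem_candidates L (Finset.mem_filter.1 hy).2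
          exact_mod_cast (Finset.card_le_card hsub).trans (twAhm_card_candidates_le L x)
      _ = 25 * (2 * p ^ 2) := mul_comm _ _
  calc ‖pairField φ L * (pairField φ L)ᴴ - (pairField φ L)ᴴ * pairField φ L‖
      = ‖∑ x : TorusSite 2 L, ∑ y : TorusSite 2 L, T x y‖ := by rw [hsum]
    _ ≤ ∑ x : TorusSite 2 L, ‖∑ y : TorusSite 2 L, T x y‖ := norm_sum_le _ _
    _ ≤ ∑ x : TorusSite 2 L, ∑ y : TorusSite 2 L, ‖T x y‖ :=
        Finset.sum_le_sum fun x _ => norm_sum_le _ _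
    _ ≤ ∑ _x : TorusSite 2 L, 25 * (2 * p ^ 2) := Finset.sum_le_sum fun x _ => hx x
    _ = 25 * (2 * p ^ 2) * (L : ℝ) ^ 2 := by
        rw [Finset.sum_const, card_univ, nsmul_eq_mul, twAhm_card_torusSite]; ring

/-- **`‖[T, P_x]‖ ≤ 45 · 2(2|t|+|U|+2|μ|) · ‖P‖`** for the grand-canonical torus Hubbard
Hamiltonian `T` (only the `≤ 5·9` local terms of `T` meeting the support of `P_x` survive).
Hastings–Koma 2006 App. A; Bratteli–Robinson II §5.2.2. [folklore] -/
theorem twAhm_norm_comm_hubbardTorusWith_localPair_le (t U μ : ℝ) (φ : Site 2 → ℝ)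
    (x : TorusSite 2 L) :
    ‖hubbardTorusWith 2 L t U μ * localPair φ L x - localPair φ L x * hubbardTorusWith 2 L t U μ‖ ≤
      45 * (2 * (2 * |t| + |U| + 2 * |μ|) *
        (2 * ∑ e ∈ insert (0 : Site 2) unitSteps, |φ e / Real.sqrt 2|)) := by
  have hA := carEvenSubalgebra_le_carSubalgebra _ (twAhm_localPair_mem_carEvenSubalgebra L φ x)
  have h := norm_commutator_hamiltonianWith_le (fermionTorusGraph 2 L) (Δ := 4)
    (fun v => SourceGas.card_filter_fermionTorusGraph_adj_le v) t U μ hA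
  rw [hubbardTorusWith]
  refine h.trans ?_
  have hcard : (((insert (0 : Site 2) unitSteps).image
      fun e => FermionTorus.ofTorusSite (x + Torus.proj L e)).card * (2 * 4 + 1) : ℕ) ≤ 45 := by
    have := twAhm_card_supp_le L x
    omega
  have hP := norm_localPair_le φ L x
  have hnn : 0 ≤ 2 * (2 * |t| + |U| + 2 * |μ|) := by positivity
  exact mul_le_mul (by exact_mod_cast hcard) (mul_le_mul_of_nonneg_left hP hnn) (by positivity)
    (by norm_num)

/-- **`‖[T, Δ_φ]‖ ≤ 45 · 2(2|t|+|U|+2|μ|) · ‖P‖ · L²`**: the commutator of the Hubbard Hamiltonian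
with the pair field is volume-linear. Hastings–Koma 2006 App. A. [folklore] -/
theorem twAhm_norm_comm_hubbardTorusWith_pairField_le (t U μ : ℝ) (φ : Site 2 → ℝ) :
    ‖hubbardTorusWith 2 L t U μ * pairField φ L - pairField φ L * hubbardTorusWith 2 L t U μ‖ ≤
      45 * (2 * (2 * |t| + |U| + 2 * |μ|) *
        (2 * ∑ e ∈ insert (0 : Site 2) unitSteps, |φ e / Real.sqrt 2|)) * (L : ℝ) ^ 2 := by
  have hsum : hubbardTorusWith 2 L t U μ * pairField φ L - pairField φ L * hubbardTorusWith 2 L t U μ =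
      ∑ x : TorusSite 2 L, (hubbardTorusWith 2 L t U μ * localPair φ L x -
        localPair φ L x * hubbardTorusWith 2 L t U μ) := by
    rw [pairField, Finset.mul_sum, Finset.sum_mul, ← Finset.sum_sub_distrib]
  rw [hsum]
  refine (norm_sum_le _ _).trans ?_
  calc ∑ x : TorusSite 2 L, ‖hubbardTorusWith 2 L t U μ * localPair φ L x -
          localPair φ L x * hubbardTorusWith 2 L t U μ‖
      ≤ ∑ _x : TorusSite 2 L, 45 * (2 * (2 * |t| + |U| + 2 * |μ|) *
          (2 * ∑ e ∈ insert (0 : Site 2) unitSteps, |φ e / Real.sqrt 2|)) :=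
        Finset.sum_le_sum fun x _ => twAhm_norm_comm_hubbardTorusWith_localPair_le L t U μ φ x
    _ = 45 * (2 * (2 * |t| + |U| + 2 * |μ|) *
          (2 * ∑ e ∈ insert (0 : Site 2) unitSteps, |φ e / Real.sqrt 2|)) * (L : ℝ) ^ 2 := by
        rw [Finset.sum_const, card_univ, nsmul_eq_mul, twAhm_card_torusSite]; ring

end Torus

end Summit.HubbardSuperconductivity.HubbardSuperconductivity.Theorems

end
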